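import Literature.RepresentationTheory.HeisenbergGroup.SkewNilpotentConjugation
import Literature.RepresentationTheory.HeisenbergGroup.SiegelUnipotentOfIsotropicImage
import Literature.RepresentationTheory.HeisenbergGroup.SchrodingerPartialFourierWeyl
import Literature.RepresentationTheory.HeisenbergGroup.QuasiInvariantFunctionalSiegelTransport
import HarnessLib

/-!
# The polarisation mover for TWO root families in opposite position: one `g₀` putting `1 + t𝔫` in Siegel-lower and
# `1 + t𝔫'` in partial-Weyl-conjugate position (piece P4-FINAL of the support-form proof of `rankOne_theta_lines_disjoint`)

Topic `RepresentationTheory/HeisenbergGroup`; namespace `Literature.RepresentationTheory.HeisenbergGroup`.  THEOREMS ONLY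
(no definition, no named fact, no `sorry`).  Pure (symplectic) linear algebra over a field `K` with `2` invertible.

Currency of the tree (`SchrodingerSiegelParabolic`, `SymplecticDarbouxMover`, `SchrodingerPartialFourierWeyl`,
`SkewNilpotentConjugation`): `W = X × Y`, `X = Y = K^ι`, the duality `β_A(x, y) = x ⬝ (A y)` of a matrix `A` with `det A` a
unit (`Matrix.toLinearMap₂' K A`), the commutator form `alt (polar β_A)`, `Sp = symplecticGroup (polar β_A)`, Siegel
unipotents `unipotentSp β b hb : (x, y) ↦ (x, y + b x)`, a splitting `e : ι₁ ⊕ ι₂ ≃ ι` of the coordinates (`resL`, `resR`,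
`glue`: `v|₁`, `v|₂`, `a ⊔ b`) and the partial Weyl element `partialWeyl A hA e` of the `ι₁`-block.

* §1 `lower_block_of_conj_eq_unipotentSp` — once `g ∈ Sp` conjugates `1 + 𝔫` to `n(c₀)` with `c₀(X) ≤ Y₁ = {y | (A y)|₂ = 0}`
  and `g (im 𝔫) ⊇ 0 × Y₁`: the second-degree datum of `c₀` is supported on the `ι₁`-block, it is anisotropic there when
  `𝔫` is anisotropic modulo its kernel, and `g (1 + t𝔫) g⁻¹ = n(t • c₀)` for every member of the family.
* §2 `upper_block_of_image` — if `g (im 𝔫') = X₁ × 0`, `X₁ = {x | x|₂ = 0}`, for a skew `𝔫'` anisotropic modulo its kernel,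
  then `g 𝔫' g⁻¹` kills `X × 0` and `0 × {y | (A y)|₁ = 0}`, hence `g (1 + t𝔫') g⁻¹ = w · n(t • c₀') · w⁻¹`,
  `w = partialWeyl A hA e`, with `c₀' x = −A⁻¹ (g 𝔫' g⁻¹ (0, A⁻¹ x))|_X` symmetric, `ι₁`-supported and anisotropic
  (`coe_partialWeyl_conj_unipotentSp_apply`).
* §3 **`exists_mover_two_rootFamilies`** — THE THEOREM.  For two skew square-zero nilpotents `𝔫, 𝔫'` whose images form a
  DUAL ISOTROPIC PAIR (`Disjoint (im 𝔫) (im 𝔫')ᗮ` and symmetrically), `dim im 𝔫 = |ι₁|`, each anisotropic modulo its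
  kernel, there are ONE `g₀ ∈ Sp` and `β_A`-symmetric `c₀, c₀'` supported on the `ι₁`-block, anisotropic there, such that
  EVERY `u ∈ Sp` acting as `1 + t𝔫` has `g₀ u g₀⁻¹ = n(t • c₀)` and every `u'` acting as `1 + t𝔫'` has
  `g₀ u' g₀⁻¹ = w · n(t • c₀') · w⁻¹`.  Proof: A-p05's mover `exists_symplectic_conj_eq_unipotentSp` (Witt extension for the
  dual pair `(im 𝔫, im 𝔫')` onto `(0 × Y₁, X₁ × 0)`) + §1 + §2.
  [MoeglinVignerasWaldspurger1987, Chap. 1 I.10–I.11, Chap. 2 II.6] [Weil1964, n° 5–6].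

Use (cell hodgecm-mathlib, row IV-4(c1) `rankOne_theta_lines_disjoint`, KEY `b4-rank-one-theta-lines-disjoint`, P4-FINAL / the
`hP34` interface of the wrapper): `A = localGram F (3+3) (gramD F 3 T) v`, `e' : Fin 4 ⊕ Fin 2 ≃ Fin (3+3)`, `𝔫, 𝔫'` the
derivatives of the diagonally doubled root subgroups of an isotropic vector `r` and its hyperbolic partner `r'` (P2/P3); the
conclusion is VERBATIM the `(g₀, c₀, c₀', hc₀, hc₀', hsupp, hsupp', hanis, hanis', hconj, hconj')` block consumed by the engine
`false_of_quasiInvariant_rootFamilies`.  Nothing about unitary groups is in this file.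

## References
* [MoeglinVignerasWaldspurger1987] C. Mœglin, M.-F. Vignéras, J.-L. Waldspurger, *Correspondances de Howe sur un corps
  p-adique*, LNM 1291 (1987), Chap. 1 I.10–I.11 (Witt), Chap. 2 II.6 (the Siegel parabolic in the Schrödinger model).
* [Weil1964] A. Weil, *Sur certains groupes d'opérateurs unitaires*, Acta Math. 111 (1964), n° 5–6, pp. 150–151.
* [Rangarao1993] R. Ranga Rao, Pacific J. Math. 157 (1993), §2.2 p. 338 (transitivity of `Sp` on dual isotropic pairs).
-/

set_option autoImplicit false

namespace Literature.RepresentationTheory.HeisenbergGroup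

open Matrix Literature.NumberTheory.Automorphic

variable {K : Type*} [Field K] [Invertible (2 : K)] {ι₁ ι₂ ι : Type*} [Fintype ι₁] [Fintype ι₂] [Fintype ι]
  [DecidableEq ι₁] [DecidableEq ι₂] [DecidableEq ι] (e : ι₁ ⊕ ι₂ ≃ ι) (A : Matrix ι ι K) (hA : IsUnit A.det)

/-! ## §1 The lower block -/

omit [DecidableEq ι₂] in
include hA in
/-- **THE LOWER BLOCK.**  If `g ∈ Sp` conjugates `u₁ = 1 + 𝔫` (`𝔫` skew) to the Siegel unipotent `n(c₀)` with
`(A (c₀ x))|₂ = 0` for all `x`, and every `(0, y)` with `(A y)|₂ = 0` is in `g (im 𝔫)`, then: the second-degree datum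
`β_A(x, c₀ x)` depends only on `x|₁`; if `𝔫` is anisotropic modulo its kernel (`alt(w, 𝔫 w) = 0 ⇒ 𝔫 w = 0`) then
`ξ ↦ β_A(ξ ⊔ 0, c₀ (ξ ⊔ 0))` is anisotropic; and EVERY `u ∈ Sp` acting as `1 + t𝔫` has `g u g⁻¹ = n(t • c₀)`.
[cite: MoeglinVignerasWaldspurger1987, Chap. 2 II.6] [cite: Weil1964, n° 6, p. 151] -/
theorem lower_block_of_conj_eq_unipotentSp (g u₁ : symplecticGroup (polar (Matrix.toLinearMap₂' K A)))
    (𝔫 : ((ι → K) × (ι → K)) →ₗ[K] ((ι → K) × (ι → K)))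
    (hskew : ∀ v w, alt (polar (Matrix.toLinearMap₂' K A)) (𝔫 v) w = -alt (polar (Matrix.toLinearMap₂' K A)) v (𝔫 w))
    (hu₁ : ∀ w, (u₁ : ((ι → K) × (ι → K)) ≃ₗ[K] ((ι → K) × (ι → K))) w = w + 𝔫 w) (c₀ : (ι → K) →ₗ[K] (ι → K))
    (hc₀ : ∀ x x', Matrix.toLinearMap₂' K A x (c₀ x') = Matrix.toLinearMap₂' K A x' (c₀ x))
    (hconj₁ : g * u₁ * g⁻¹ = unipotentSp (Matrix.toLinearMap₂' K A) c₀ hc₀) (h8 : ∀ x, resR e (A *ᵥ c₀ x) = 0)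
    (R2 : ∀ y, resR e (A *ᵥ y) = 0 →
      ∃ v, (g : ((ι → K) × (ι → K)) ≃ₗ[K] ((ι → K) × (ι → K))) (𝔫 v) = (0, y))
    (han : ∀ w, alt (polar (Matrix.toLinearMap₂' K A)) w (𝔫 w) = 0 → 𝔫 w = 0) :
    (∀ x, Matrix.toLinearMap₂' K A x (c₀ x) =
        Matrix.toLinearMap₂' K A (glue e (resL e x) 0) (c₀ (glue e (resL e x) 0))) ∧
      (∀ ξ : ι₁ → K, Matrix.toLinearMap₂' K A (glue e ξ 0) (c₀ (glue e ξ 0)) = 0 → ξ = 0) ∧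
      (∀ (t : K) (u : symplecticGroup (polar (Matrix.toLinearMap₂' K A))),
        (∀ w, (u : ((ι → K) × (ι → K)) ≃ₗ[K] ((ι → K) × (ι → K))) w = w + t • 𝔫 w) →
          g * u * g⁻¹ = unipotentSp (Matrix.toLinearMap₂' K A) (t • c₀)
            (symm_smul_of_symm (Matrix.toLinearMap₂' K A) c₀ hc₀ t)) := by
  have hN := nondegenerate_alt_polar_toLinearMap₂' A hA
  -- the conjugated nilpotent `Ng = g 𝔫 g⁻¹ : (x, y) ↦ (0, c₀ x)`
  obtain ⟨Ng, hNg⟩ : ∃ Ng : ((ι → K) × (ι → K)) →ₗ[K] ((ι → K) × (ι → K)),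
      ∀ w, Ng w = (g : ((ι → K) × (ι → K)) ≃ₗ[K] ((ι → K) × (ι → K)))
        (𝔫 ((g : ((ι → K) × (ι → K)) ≃ₗ[K] ((ι → K) × (ι → K))).symm w)) :=
    ⟨((g : ((ι → K) × (ι → K)) ≃ₗ[K] ((ι → K) × (ι → K))) : ((ι → K) × (ι → K)) →ₗ[K] ((ι → K) × (ι → K))) ∘ₗ
        𝔫 ∘ₗ ((g : ((ι → K) × (ι → K)) ≃ₗ[K] ((ι → K) × (ι → K))).symm :
          ((ι → K) × (ι → K)) →ₗ[K] ((ι → K) × (ι → K))), fun w => rfl⟩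
  have hNgskew : ∀ p q, alt (polar (Matrix.toLinearMap₂' K A)) (Ng p) q =
      -alt (polar (Matrix.toLinearMap₂' K A)) p (Ng q) := fun p q => by
    rw [hNg, hNg]; exact conj_skew _ g hskew p q
  have hNgc₀ : ∀ w, Ng w = (0, c₀ w.1) := fun w => by
    rw [hNg]; exact conj_apply_nil_of_conj_eq_unipotentSp _ g u₁ 𝔫 hu₁ c₀ hc₀ hconj₁ w
  -- `c₀` kills `{x | x|₁ = 0}`
  have h7 : ∀ x, resL e x = 0 → c₀ x = 0 := fun x hx => by
    have h0 : Ng (x, 0) = 0 := apply_eq_zero_of_forall_alt _ hN hNgskew _ fun q => by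
      rw [hNgc₀]
      simp only [alt_polar_toLinearMap₂'_apply, Matrix.mulVec_zero, zero_dotProduct, sub_zero]
      rw [dotProduct_of_resR_eq_zero e x (h8 _), hx, zero_dotProduct]
    rw [hNgc₀] at h0
    simpa using (Prod.ext_iff.1 h0).2
  refine ⟨toLinearMap₂'_self_eq_of_support e A c₀ h8 h7, fun ξ hξ => ?_, fun t u hu =>
    conj_eq_unipotentSp_smul _ g u₁ 𝔫 hu₁ c₀ hc₀ hconj₁ t u hu _⟩
  -- anisotropy: `Ng (ξ ⊔ 0, 0) = 0`, hence `(ξ ⊔ 0, 0) ⊥ im Ng ⊇ 0 × Y₁`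
  have h0 : Ng (glue e ξ 0, 0) = 0 := by
    rw [hNg]
    refine conj_apply_eq_zero_of_alt_self _ g han _ ?_
    rw [← hNg, hNgc₀]
    simpa only [alt_polar_toLinearMap₂'_apply, Matrix.mulVec_zero, zero_dotProduct, sub_zero,
      Matrix.toLinearMap₂'_apply'] using hξ
  refine eq_zero_of_forall_dotProduct_eq_zero ξ fun η => ?_
  obtain ⟨v, hv⟩ := R2 (A⁻¹ *ᵥ glue e η 0) (resR_mulVec_inv_mulVec_glue_zero e A hA η)
  have h1 : alt (polar (Matrix.toLinearMap₂' K A)) (glue e ξ 0, 0)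
      (Ng ((g : ((ι → K) × (ι → K)) ≃ₗ[K] ((ι → K) × (ι → K))) v)) = 0 := by
    rw [← neg_eq_zero, ← hNgskew, h0, map_zero, LinearMap.zero_apply]
  rw [hNg, LinearEquiv.symm_apply_apply, hv] at h1
  simp only [alt_polar_toLinearMap₂'_apply, Matrix.mulVec_mulVec, Matrix.mul_nonsing_inv A hA, Matrix.one_mulVec,
    Matrix.mulVec_zero, dotProduct_zero, sub_zero, glue_zero_dotProduct, resL_glue] at h1
  rwa [dotProduct_comm] at h1

/-! ## §2 The upper block -/

include hA in
/-- **THE UPPER BLOCK.**  Let `𝔫'` be skew for `alt (polar β_A)` and anisotropic modulo its kernel, and let `g ∈ Sp` carry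
`im 𝔫'` ONTO `X₁ × 0`, `X₁ = {x | x|₂ = 0}`.  Then `g 𝔫' g⁻¹` kills `X × 0` and `0 × {y | (A y)|₁ = 0}` (skewness), so
with `c₀' x := −A⁻¹ ((g 𝔫' g⁻¹ (0, A⁻¹ x))|_X)` — `β_A`-symmetric, `ι₁`-supported, anisotropic on the `ι₁`-block — EVERY
`u ∈ Sp` acting as `1 + t𝔫'` satisfies `g u g⁻¹ = w · n(t • c₀') · w⁻¹`, `w = partialWeyl A hA e`
(`coe_partialWeyl_conj_unipotentSp_apply`).  [cite: MoeglinVignerasWaldspurger1987, Chap. 2 II.6] [cite: Weil1964, n° 6, p. 151] -/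
theorem upper_block_of_image (g : symplecticGroup (polar (Matrix.toLinearMap₂' K A)))
    (𝔫' : ((ι → K) × (ι → K)) →ₗ[K] ((ι → K) × (ι → K)))
    (hskew' : ∀ v w, alt (polar (Matrix.toLinearMap₂' K A)) (𝔫' v) w = -alt (polar (Matrix.toLinearMap₂' K A)) v (𝔫' w))
    (R3 : ∀ v, ((g : ((ι → K) × (ι → K)) ≃ₗ[K] ((ι → K) × (ι → K))) (𝔫' v)).2 = 0 ∧
      resR e ((g : ((ι → K) × (ι → K)) ≃ₗ[K] ((ι → K) × (ι → K))) (𝔫' v)).1 = 0)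
    (R4 : ∀ x, resR e x = 0 → ∃ v, (g : ((ι → K) × (ι → K)) ≃ₗ[K] ((ι → K) × (ι → K))) (𝔫' v) = (x, 0))
    (han' : ∀ w, alt (polar (Matrix.toLinearMap₂' K A)) w (𝔫' w) = 0 → 𝔫' w = 0) :
    ∃ (c₀' : (ι → K) →ₗ[K] (ι → K))
      (hc₀' : ∀ x x', Matrix.toLinearMap₂' K A x (c₀' x') = Matrix.toLinearMap₂' K A x' (c₀' x)),
      (∀ x, Matrix.toLinearMap₂' K A x (c₀' x) =
        Matrix.toLinearMap₂' K A (glue e (resL e x) 0) (c₀' (glue e (resL e x) 0))) ∧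
      (∀ ξ : ι₁ → K, Matrix.toLinearMap₂' K A (glue e ξ 0) (c₀' (glue e ξ 0)) = 0 → ξ = 0) ∧
      (∀ (t : K) (u : symplecticGroup (polar (Matrix.toLinearMap₂' K A))),
        (∀ w, (u : ((ι → K) × (ι → K)) ≃ₗ[K] ((ι → K) × (ι → K))) w = w + t • 𝔫' w) →
          g * u * g⁻¹ = partialWeyl A hA e * unipotentSp (Matrix.toLinearMap₂' K A) (t • c₀')
            (symm_smul_of_symm (Matrix.toLinearMap₂' K A) c₀' hc₀' t) * (partialWeyl A hA e)⁻¹) := by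
  have hN := nondegenerate_alt_polar_toLinearMap₂' A hA
  -- the conjugated nilpotent `N' = g 𝔫' g⁻¹`
  obtain ⟨N', hN'⟩ : ∃ N' : ((ι → K) × (ι → K)) →ₗ[K] ((ι → K) × (ι → K)),
      ∀ w, N' w = (g : ((ι → K) × (ι → K)) ≃ₗ[K] ((ι → K) × (ι → K)))
        (𝔫' ((g : ((ι → K) × (ι → K)) ≃ₗ[K] ((ι → K) × (ι → K))).symm w)) :=
    ⟨((g : ((ι → K) × (ι → K)) ≃ₗ[K] ((ι → K) × (ι → K))) : ((ι → K) × (ι → K)) →ₗ[K] ((ι → K) × (ι → K))) ∘ₗ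
        𝔫' ∘ₗ ((g : ((ι → K) × (ι → K)) ≃ₗ[K] ((ι → K) × (ι → K))).symm :
          ((ι → K) × (ι → K)) →ₗ[K] ((ι → K) × (ι → K))), fun w => rfl⟩
  have hN'skew : ∀ p q, alt (polar (Matrix.toLinearMap₂' K A)) (N' p) q =
      -alt (polar (Matrix.toLinearMap₂' K A)) p (N' q) := fun p q => by
    rw [hN', hN']; exact conj_skew _ g hskew' p q
  have hN'2 : ∀ w, (N' w).2 = 0 := fun w => by rw [hN']; exact (R3 _).1
  have hN'R : ∀ w, resR e (N' w).1 = 0 := fun w => by rw [hN']; exact (R3 _).2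
  -- `N'` kills `X × 0` and `0 × {y | (A y)|₁ = 0}`
  have hN'X : ∀ x, N' (x, 0) = 0 := fun x =>
    apply_eq_zero_of_forall_alt _ hN hN'skew _ fun q => by
      simp only [alt_polar_toLinearMap₂'_apply, hN'2, Matrix.mulVec_zero, dotProduct_zero, sub_zero]
  have hN'Y : ∀ y, resL e (A *ᵥ y) = 0 → N' (0, y) = 0 := fun y hy =>
    apply_eq_zero_of_forall_alt _ hN hN'skew _ fun q => by
      simp only [alt_polar_toLinearMap₂'_apply, zero_dotProduct, zero_sub, neg_eq_zero]
      rw [dotProduct_of_resR_eq_zero_left e (hN'R q), hy, dotProduct_zero]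
  have hN'xy : ∀ x y, N' (x, y) = ((N' (0, y)).1, 0) := fun x y => by
    have hsplit : (x, y) = (x, 0) + (0, y) := by simp
    rw [hsplit, map_add, hN'X, zero_add]
    exact Prod.ext rfl (hN'2 _)
  -- the upper datum `c₀' x = -A⁻¹ (N' (0, A⁻¹ x)).1`
  obtain ⟨c₀', hc₀'⟩ : ∃ c : (ι → K) →ₗ[K] (ι → K), ∀ x, c x = -(A⁻¹ *ᵥ (N' (0, A⁻¹ *ᵥ x)).1) :=
    ⟨-(Matrix.toLin' A⁻¹ ∘ₗ LinearMap.fst K (ι → K) (ι → K) ∘ₗ N' ∘ₗ LinearMap.inr K (ι → K) (ι → K) ∘ₗ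
        Matrix.toLin' A⁻¹), fun x => by
      simp only [LinearMap.neg_apply, LinearMap.comp_apply, Matrix.toLin'_apply, LinearMap.fst_apply,
        LinearMap.inr_apply]⟩
  have hAc₀' : ∀ x, A *ᵥ c₀' x = -(N' (0, A⁻¹ *ᵥ x)).1 := fun x => by
    rw [hc₀', Matrix.mulVec_neg, Matrix.mulVec_mulVec, Matrix.mul_nonsing_inv A hA, Matrix.one_mulVec]
  have h7' : ∀ x, resL e x = 0 → c₀' x = 0 := fun x hx => by
    have h0 : N' (0, A⁻¹ *ᵥ x) = 0 :=
      hN'Y _ (by rw [Matrix.mulVec_mulVec, Matrix.mul_nonsing_inv A hA, Matrix.one_mulVec, hx])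
    rw [hc₀', h0, Prod.fst_zero, Matrix.mulVec_zero, neg_zero]
  have h8' : ∀ x, resR e (A *ᵥ c₀' x) = 0 := fun x => by rw [hAc₀', resR_neg, hN'R, neg_zero]
  have hc₀'s : ∀ x x', Matrix.toLinearMap₂' K A x (c₀' x') = Matrix.toLinearMap₂' K A x' (c₀' x) := fun x x' => by
    have h := hN'skew (0, A⁻¹ *ᵥ x') (0, A⁻¹ *ᵥ x)
    simp only [alt_polar_toLinearMap₂'_apply, hN'2, Matrix.mulVec_zero, dotProduct_zero, sub_zero, zero_sub, neg_neg,
      Matrix.mulVec_mulVec, Matrix.mul_nonsing_inv A hA, Matrix.one_mulVec] at h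
    rw [Matrix.toLinearMap₂'_apply', Matrix.toLinearMap₂'_apply', hAc₀', hAc₀', dotProduct_neg, dotProduct_neg,
      dotProduct_comm x, dotProduct_comm x', h]
  -- the `ι₁`-block map `c₁` with `A (c₀' x) = (c₁ x|₁) ⊔ 0`
  obtain ⟨gl, hgl⟩ := exists_linearMap_glue_zero (K := K) e
  obtain ⟨c₁, hc₁⟩ : ∃ c₁ : (ι₁ → K) →ₗ[K] (ι₁ → K), ∀ ξ, c₁ ξ = resL e (A *ᵥ c₀' (glue e ξ 0)) :=
    ⟨LinearMap.funLeft K K (fun i => e (Sum.inl i)) ∘ₗ Matrix.toLin' A ∘ₗ c₀' ∘ₗ gl, fun ξ => by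
      rw [LinearMap.comp_apply, LinearMap.comp_apply, LinearMap.comp_apply, hgl, Matrix.toLin'_apply]; rfl⟩
  have hcc₁ : ∀ x, A *ᵥ c₀' x = glue e (c₁ (resL e x)) 0 := fun x => by
    have hcx : c₀' x = c₀' (glue e (resL e x) 0) := by
      rw [← sub_eq_zero, ← map_sub]
      exact h7' _ (resL_sub_glue e x)
    rw [hc₁, hcx]
    exact eq_glue_resL_of_resR_eq_zero e (h8' _)
  have hcc₁t : ∀ (t : K) (x : ι → K), A *ᵥ (t • c₀') x = glue e ((t • c₁) (resL e x)) 0 := fun t x => by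
    rw [LinearMap.smul_apply, LinearMap.smul_apply, Matrix.mulVec_smul, hcc₁, smul_glue₁₂, smul_zero]
  refine ⟨c₀', hc₀'s, toLinearMap₂'_self_eq_of_support e A c₀' h8' h7', fun ξ hξ => ?_, fun t u hu => ?_⟩
  · -- anisotropy: `N' (0, A⁻¹(ξ ⊔ 0)) = 0`, hence `(0, A⁻¹(ξ ⊔ 0)) ⊥ im N' = X₁ × 0`
    have hAy : A *ᵥ (A⁻¹ *ᵥ glue e ξ 0) = glue e ξ 0 := by
      rw [Matrix.mulVec_mulVec, Matrix.mul_nonsing_inv A hA, Matrix.one_mulVec]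
    have h0 : N' (0, A⁻¹ *ᵥ glue e ξ 0) = 0 := by
      rw [hN']
      refine conj_apply_eq_zero_of_alt_self _ g han' _ ?_
      rw [← hN']
      rw [Matrix.toLinearMap₂'_apply', hAc₀', dotProduct_neg, neg_eq_zero, dotProduct_comm] at hξ
      simpa only [alt_polar_toLinearMap₂'_apply, zero_dotProduct, zero_sub, neg_eq_zero, hAy] using hξ
    refine eq_zero_of_forall_dotProduct_eq_zero ξ fun η => ?_
    obtain ⟨v, hv⟩ := R4 (glue e η 0) (resR_glue e η 0)
    have h1 : alt (polar (Matrix.toLinearMap₂' K A)) (0, A⁻¹ *ᵥ glue e ξ 0)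
        (N' ((g : ((ι → K) × (ι → K)) ≃ₗ[K] ((ι → K) × (ι → K))) v)) = 0 := by
      rw [← neg_eq_zero, ← hN'skew, h0, map_zero, LinearMap.zero_apply]
    rw [hN', LinearEquiv.symm_apply_apply, hv] at h1
    simpa only [alt_polar_toLinearMap₂'_apply, hAy, Matrix.mulVec_zero, dotProduct_zero, zero_sub, neg_eq_zero,
      glue_zero_dotProduct, resL_glue] using h1
  · -- the family: `g (1 + t𝔫') g⁻¹ = w n(t c₀') w⁻¹`
    refine Subtype.ext (LinearEquiv.ext fun w => ?_)
    rw [coe_partialWeyl_conj_unipotentSp_apply A hA e (t • c₀') _ (t • c₁) (hcc₁t t) w,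
      coe_conj_apply_of_apply_eq_add _ g u (t • 𝔫') (fun w => by rw [hu, LinearMap.smul_apply]) w,
      LinearMap.smul_apply, map_smul, ← hN', hN'xy w.1 w.2, ← hcc₁t, LinearMap.smul_apply, Matrix.mulVec_smul,
      hAc₀', Matrix.mulVec_mulVec, Matrix.nonsing_inv_mul A hA, Matrix.one_mulVec]
    refine Prod.ext ?_ ?_
    · simp only [Prod.fst_add, Prod.smul_mk, smul_neg, sub_neg_eq_add]
    · simp only [Prod.snd_add, Prod.smul_mk, smul_zero, add_zero]

/-! ## §3 The mover for two root families -/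

include hA in
/-- **THE POLARISATION MOVER FOR TWO ROOT FAMILIES IN OPPOSITE POSITION.**  Let `𝔫, 𝔫'` be endomorphisms of `W = K^ι × K^ι`,
skew for `alt (polar β_A)` and square-zero, whose images form a DUAL ISOTROPIC PAIR (`im 𝔫 ∩ (im 𝔫')ᗮ = 0`,
`im 𝔫' ∩ (im 𝔫)ᗮ = 0`) with `dim im 𝔫 = |ι₁|`, each ANISOTROPIC MODULO ITS KERNEL (`alt(w, 𝔫 w) = 0 ⇒ 𝔫 w = 0`).  Then
there are ONE `g₀ ∈ Sp(W)` and `β_A`-symmetric `c₀, c₀' : X → Y` whose second-degree data are SUPPORTED ON THE `ι₁`-BLOCK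
and ANISOTROPIC there, such that every `u ∈ Sp` acting as `1 + t𝔫` has `g₀ u g₀⁻¹ = n(t • c₀)` (Siegel-lower) and every
`u'` acting as `1 + t𝔫'` has `g₀ u' g₀⁻¹ = w n(t • c₀') w⁻¹` with `w = partialWeyl A hA e` (the conjugate of a Siegel
unipotent by the Weyl element of the `ι₁`-block).  Witt extension for the dual pair `(im 𝔫, im 𝔫') ↦ (0 × Y₁, X₁ × 0)`
(`exists_symplectic_conj_eq_unipotentSp`) and the structure of the Siegel parabolic (§1, §2).
[cite: MoeglinVignerasWaldspurger1987, Chap. 1 I.10–I.11, Chap. 2 II.6] [cite: Weil1964, n° 6, p. 151]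
[cite: Rangarao1993, §2.2 p. 338] -/
theorem exists_mover_two_rootFamilies
    (𝔫 𝔫' : ((ι → K) × (ι → K)) →ₗ[K] ((ι → K) × (ι → K)))
    (hskew : ∀ v w, alt (polar (Matrix.toLinearMap₂' K A)) (𝔫 v) w = -alt (polar (Matrix.toLinearMap₂' K A)) v (𝔫 w))
    (hskew' : ∀ v w, alt (polar (Matrix.toLinearMap₂' K A)) (𝔫' v) w = -alt (polar (Matrix.toLinearMap₂' K A)) v (𝔫' w))
    (hsq : 𝔫 ∘ₗ 𝔫 = 0) (hsq' : 𝔫' ∘ₗ 𝔫' = 0)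
    (hd₁ : Disjoint (LinearMap.range 𝔫)
      (LinearMap.BilinForm.orthogonal (alt (polar (Matrix.toLinearMap₂' K A))) (LinearMap.range 𝔫')))
    (hd₂ : Disjoint (LinearMap.range 𝔫')
      (LinearMap.BilinForm.orthogonal (alt (polar (Matrix.toLinearMap₂' K A))) (LinearMap.range 𝔫)))
    (hrank : Module.finrank K (LinearMap.range 𝔫) = Fintype.card ι₁)
    (han : ∀ w, alt (polar (Matrix.toLinearMap₂' K A)) w (𝔫 w) = 0 → 𝔫 w = 0)
    (han' : ∀ w, alt (polar (Matrix.toLinearMap₂' K A)) w (𝔫' w) = 0 → 𝔫' w = 0) :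
    ∃ (g₀ : symplecticGroup (polar (Matrix.toLinearMap₂' K A))) (c₀ c₀' : (ι → K) →ₗ[K] (ι → K))
      (hc₀ : ∀ x x', Matrix.toLinearMap₂' K A x (c₀ x') = Matrix.toLinearMap₂' K A x' (c₀ x))
      (hc₀' : ∀ x x', Matrix.toLinearMap₂' K A x (c₀' x') = Matrix.toLinearMap₂' K A x' (c₀' x)),
      (∀ x, Matrix.toLinearMap₂' K A x (c₀ x) =
        Matrix.toLinearMap₂' K A (glue e (resL e x) 0) (c₀ (glue e (resL e x) 0))) ∧
      (∀ x, Matrix.toLinearMap₂' K A x (c₀' x) =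
        Matrix.toLinearMap₂' K A (glue e (resL e x) 0) (c₀' (glue e (resL e x) 0))) ∧
      (∀ ξ : ι₁ → K, Matrix.toLinearMap₂' K A (glue e ξ 0) (c₀ (glue e ξ 0)) = 0 → ξ = 0) ∧
      (∀ ξ : ι₁ → K, Matrix.toLinearMap₂' K A (glue e ξ 0) (c₀' (glue e ξ 0)) = 0 → ξ = 0) ∧
      (∀ (t : K) (u : symplecticGroup (polar (Matrix.toLinearMap₂' K A))),
        (∀ w, (u : ((ι → K) × (ι → K)) ≃ₗ[K] ((ι → K) × (ι → K))) w = w + t • 𝔫 w) →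
          g₀ * u * g₀⁻¹ = unipotentSp (Matrix.toLinearMap₂' K A) (t • c₀)
            (symm_smul_of_symm (Matrix.toLinearMap₂' K A) c₀ hc₀ t)) ∧
      (∀ (t : K) (u : symplecticGroup (polar (Matrix.toLinearMap₂' K A))),
        (∀ w, (u : ((ι → K) × (ι → K)) ≃ₗ[K] ((ι → K) × (ι → K))) w = w + t • 𝔫' w) →
          g₀ * u * g₀⁻¹ = partialWeyl A hA e * unipotentSp (Matrix.toLinearMap₂' K A) (t • c₀')
            (symm_smul_of_symm (Matrix.toLinearMap₂' K A) c₀' hc₀' t) * (partialWeyl A hA e)⁻¹) := by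
  classical
  -- (0) non-degeneracy, the unipotent `1 + 𝔫`, isotropy of `im 𝔫'`
  have hN := nondegenerate_alt_polar_toLinearMap₂' A hA
  obtain ⟨u₁, hu₁⟩ := exists_symplecticGroup_apply_eq_add (Matrix.toLinearMap₂' K A) 𝔫 hskew hsq
  have hI₂ := isotropic_range_of_skew_sq (Matrix.toLinearMap₂' K A) 𝔫' hskew' hsq'
  -- (1) the standard dual pair `(X₁ × 0, 0 × Y₁)`
  obtain ⟨X₁, hX₁⟩ : ∃ X₁ : Submodule K (ι → K), ∀ x, x ∈ X₁ ↔ resR e x = 0 :=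
    ⟨LinearMap.ker (LinearMap.funLeft K K fun j => e (Sum.inr j)), fun x => by rw [LinearMap.mem_ker]; rfl⟩
  obtain ⟨Y₁, hY₁, hY₁d⟩ : ∃ Y₁ : Submodule K (ι → K), (∀ y, y ∈ Y₁ ↔ resR e (A *ᵥ y) = 0) ∧
      Module.finrank K Y₁ = Fintype.card ι₁ :=
    ⟨LinearMap.ker (LinearMap.funLeft K K (fun j => e (Sum.inr j)) ∘ₗ Matrix.toLin' A), fun y => by
      rw [LinearMap.mem_ker, LinearMap.comp_apply, Matrix.toLin'_apply]; rfl, finrank_ker_resR_mulVec e A hA⟩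
  have h₁ : ∀ x ∈ X₁, (∀ y ∈ Y₁, Matrix.toLinearMap₂' K A x y = 0) → x = 0 := fun x hx h =>
    eq_zero_of_resR_eq_zero_of_forall e A hA x ((hX₁ x).1 hx) fun y hy => by
      rw [← Matrix.toLinearMap₂'_apply']; exact h y ((hY₁ y).2 hy)
  have h₂ : ∀ y ∈ Y₁, (∀ x ∈ X₁, Matrix.toLinearMap₂' K A x y = 0) → y = 0 := fun y hy h =>
    eq_zero_of_resR_mulVec_eq_zero_of_forall e A hA y ((hY₁ y).1 hy) fun x hx => by
      rw [← Matrix.toLinearMap₂'_apply']; exact h x ((hX₁ x).2 hx)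
  -- (2) the mover of the dual pair `(im 𝔫, im 𝔫')` and the lower Siegel unipotent
  obtain ⟨g, hgR, hgR', c₀, hc₀, hc₀Y, hconj₁⟩ := exists_symplectic_conj_eq_unipotentSp (Matrix.toLinearMap₂' K A) hN
    hskew hsq u₁ hu₁ hI₂ hd₁ hd₂ X₁ Y₁ h₁ h₂ (hrank.trans hY₁d.symm)
  -- pointwise images: `g (im 𝔫) ⊇ 0 × Y₁`, `g (im 𝔫') = X₁ × 0`
  have R2 : ∀ y, resR e (A *ᵥ y) = 0 →
      ∃ v, (g : ((ι → K) × (ι → K)) ≃ₗ[K] ((ι → K) × (ι → K))) (𝔫 v) = (0, y) := fun y hy => by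
    have hv : LinearMap.inr K (ι → K) (ι → K) y ∈ (LinearMap.range 𝔫).map
        ((g : ((ι → K) × (ι → K)) ≃ₗ[K] ((ι → K) × (ι → K))) : ((ι → K) × (ι → K)) →ₗ[K] ((ι → K) × (ι → K))) :=
      hgR ▸ Submodule.mem_map_of_mem ((hY₁ y).2 hy)
    obtain ⟨p, ⟨v, rfl⟩, hpv⟩ := Submodule.mem_map.1 hv
    rw [LinearEquiv.coe_coe] at hpv
    exact ⟨v, by rw [hpv, LinearMap.inr_apply]⟩
  have R3 : ∀ v, ((g : ((ι → K) × (ι → K)) ≃ₗ[K] ((ι → K) × (ι → K))) (𝔫' v)).2 = 0 ∧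
      resR e ((g : ((ι → K) × (ι → K)) ≃ₗ[K] ((ι → K) × (ι → K))) (𝔫' v)).1 = 0 := fun v => by
    have hv : ((g : ((ι → K) × (ι → K)) ≃ₗ[K] ((ι → K) × (ι → K))) : ((ι → K) × (ι → K)) →ₗ[K] ((ι → K) × (ι → K)))
        (𝔫' v) ∈ X₁.map (LinearMap.inl K (ι → K) (ι → K)) :=
      hgR' ▸ Submodule.mem_map_of_mem (LinearMap.mem_range_self 𝔫' v)
    obtain ⟨x, hx, hxv⟩ := Submodule.mem_map.1 hv
    rw [LinearEquiv.coe_coe] at hxv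
    rw [← hxv, LinearMap.inl_apply]
    exact ⟨rfl, (hX₁ x).1 hx⟩
  have R4 : ∀ x, resR e x = 0 →
      ∃ v, (g : ((ι → K) × (ι → K)) ≃ₗ[K] ((ι → K) × (ι → K))) (𝔫' v) = (x, 0) := fun x hx => by
    have hv : LinearMap.inl K (ι → K) (ι → K) x ∈ (LinearMap.range 𝔫').map
        ((g : ((ι → K) × (ι → K)) ≃ₗ[K] ((ι → K) × (ι → K))) : ((ι → K) × (ι → K)) →ₗ[K] ((ι → K) × (ι → K))) :=
      hgR' ▸ Submodule.mem_map_of_mem ((hX₁ x).2 hx)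
    obtain ⟨p, ⟨v, rfl⟩, hpv⟩ := Submodule.mem_map.1 hv
    rw [LinearEquiv.coe_coe] at hpv
    exact ⟨v, by rw [hpv, LinearMap.inl_apply]⟩
  -- (3) the two blocks
  obtain ⟨hsupp, hanis, hlow⟩ := lower_block_of_conj_eq_unipotentSp e A hA g u₁ 𝔫 hskew hu₁ c₀ hc₀ hconj₁
    (fun x => (hY₁ _).1 (hc₀Y x)) R2 han
  obtain ⟨c₀', hc₀', hsupp', hanis', hup⟩ := upper_block_of_image e A hA g 𝔫' hskew' R3 R4 han'
  exact ⟨g, c₀, c₀', hc₀, hc₀', hsupp, hsupp', hanis, hanis', hlow, hup⟩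

end Literature.RepresentationTheory.HeisenbergGroup
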